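import Mathlib.Algebra.Group.ForwardDiff
import Mathlib.Algebra.Polynomial.Inductions
import Literature.Computability.Complexity.BonamiLevelK
import Literature.Computability.QuantumComplexity.InfluenceBounds
import Literature.Computability.QuantumComplexity.DFKOInfluenceBound
import HarnessLib

/-!
# Bounded low-degree polynomials have a variable of influence `≥ Var³/2^{21 d}` — discharge of `dfko2007_influence_bounded`

Topic `Computability/QuantumComplexity`. This file proves the named fact
`Literature.Computability.QuantumComplexity.dfko2007_influence_bounded` of `DFKOInfluenceBound.lean`
(Dinur–Friedgut–Kindler–O'Donnell 2007, consequence of Thm. 1.6 = preprint Thm. 3, as recorded by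
Aaronson–Ambainis 2014, p. 6 and O'Donnell 2014, Ch. 8 notes: `MaxInf[p] ≥ poly(Var[p])/2^{O(deg p)}`
for `[0,1]`-bounded `p`) as `dfko2007_influence_bounded_holds`, with the constants `a = 3`, `C = 21`:
for `p` of total degree `≤ d` (`d ≥ 1`), `0 ≤ p ≤ 1` on `{0,1}^N` and `0 < ε ≤ Var[p]`, some `i` has
`Inf_i[p] ≥ ε³ / 2^{21 d}`.

## The printed proof and what is formalized

I. Dinur, E. Friedgut, G. Kindler, R. O'Donnell, *On the Fourier tails of bounded functions over the
discrete cube*, Israel J. Math. 160 (2007) 389–412, prove the LARGE-DEVIATION statement Thm. 1.6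
(`Pr[|f| ≥ t] ≥ exp(-C t² k² log k)` for degree-`k` `f` with `∑_{S≠∅} f̂(S)² = 1` and all
`Inf_i(f) ≤ t⁻² C^{-k}`) in two steps:

* **§3 (Lemma 1.5, "random noise with a random rate").** For a point `x₀`, `p_{x₀}(ρ) = T_ρ f(x₀)` is a
  polynomial of degree `≤ k` in the noise rate `ρ` whose linear coefficient is the linear part
  `ℓ(x₀) = ∑_i f̂({i}) x₀,ᵢ`; an extremal property of polynomials bounded at finitely many points of
  `[-1,1]` (Chebyshev, Lemma 2.10 / Cor. 2.11–2.12) yields a rate `ρ` with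
  `|T_ρ f(x₀)| ≥ |ℓ(x₀)|/(2k+2)`, and `T_ρ f(x₀)` is an average of values of `f`.
* **§4 (Thm. 1.6 from Lemma 4.1, random restriction).** Fixing a random set of coordinates brings a
  constant fraction of the Fourier weight down to level 1 of the restricted function
  (`γ_i = ∑_{S∩U={i}} f̂(S)²`, `E[γ_i]` computed from `Pr[S ∩ U = {i}]`), while the restricted level-1
  coefficients stay small because their fourth moments are controlled by Bonami–Beckner.

The vendored consequence only needs the SUP-NORM content of this argument (a bounded function cannot
take the large value, so the hypothesis "all influences small" must fail), and that is what is proved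
here, following the same two steps with all probabilistic estimates replaced by averages:

1. `DFKO.noiseSum_eq`, `DFKO.noiseSum_mem` — `T_s h(y) = ∑_T ĥ(T) s^{|T|} χ_T(y)` is the average of `h`
   against the nonnegative kernel `2^{-m} ∏_i (1 + s χ_i(x) χ_i(y))` of mass `1`, so `T_s h(y) ∈ [0,1]`
   for `0 ≤ h ≤ 1`, `|s| ≤ 1` (O'Donnell 2014, §2.4).
2. `DFKO.abs_coeff_one_le` — in place of the Chebyshev extremal property (only the order `C^k` of the
   constant matters here): a real polynomial `P` of degree `≤ d` with `P(k) ∈ [0,1]` for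
   `k = 0, …, d` has `|P.coeff 1| ≤ 2^d`, because the `d`-th forward difference of `(P - P(0))/X`
   (degree `< d`) vanishes (Mathlib `Polynomial.fwdDiff_iter_eq_zero_of_degree_lt`,
   `fwdDiff_iter_eq_sum_shift`) and `|(P(k) - P(0))/k| ≤ 1`.
3. `DFKO.sum_abs_fourier_singleton_le` — hence (with `P(X) = ∑_T ĥ(T) χ_T(y) d^{-|T|} X^{|T|}`,
   `P(k) = T_{k/d} h(y)`, and `y_i = [ĥ({i}) < 0]`) **the level-1 spectral norm of a `[0,1]`-valued
   function of degree `≤ d` is at most `d 2^d`** (sup-norm form of Lemma 1.5), and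
   (`DFKO.sum_sq_fourier_singleton_le`) `∑_i ĥ({i})² ≤ d 2^d θ + θ⁻² ∑_i ĥ({i})⁴` for every `θ > 0`.
4. `DFKO.sum_sum_sq_fourier_singleton_piecewise`, `DFKO.sum_fourier_singleton_piecewise_pow_four_le` —
   for the restrictions `g_{A←β} = g ∘ A.piecewise β` (O'Donnell Prop. 3.21, `FourierTails.lean`):
   `2^{-m} ∑_β ∑_i ĝ_{A←β}({i})² = ∑_{|S∖A|=1} ĝ(S)²` and, by Bonami's lemma with `r = 2`
   (`bonami_even_moment`, `BonamiLevelK.lean`) applied to the degree-`(d-1)` Walsh sum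
   `β ↦ ĝ_{A←β}({i}) = ∑_{U⊆A} ĝ({i}∪U) χ_U(β)`, `2^{-m} ∑_β ĝ_{A←β}({i})⁴ ≤ 9^{d-1} (∑_{S∋i} ĝ(S)²)²`.
   With `∑_i ∑_{S∋i} ĝ(S)² ≤ d` this gives (`DFKO.sum_filter_card_sdiff_eq_one_le`)
   `∑_{|S∖A|=1} ĝ(S)² ≤ d 2^d θ + 9^{d-1} d t/θ²` whenever all `∑_{S∋i} ĝ(S)² ≤ t`.
5. `DFKO.sum_subsetWeight_ite_card_sdiff_eq_one_ge`, `DFKO.tailWeight_one_le` — averaging over `A`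
   with the product weights `subsetWeight q` of `FourierTails.lean`, `q = 1/(2d)`:
   `Pr[|S∖A| = 1] ≥ 2E|S∖A| - E|S∖A|² ≥ 1/(4d)` for `1 ≤ |S| ≤ d`, so
   `W^{≥1}[g] ≤ 4d (d 2^d θ + 9^{d-1} d t/θ²)`.
6. `DFKO.tailWeight_one_pow_three_le` — the choice `θ = W^{≥1}[g]/(8 d² 2^d)` gives
   `(W^{≥1}[g])³ ≤ 512 d⁶ 4^d 9^{d-1} t ≤ 2^{21 d} t`; with `Var[p] = W^{≥1}[p]`
   (`boolVariance_eq_tailWeight_one`) and `Inf_i[p] = 4 ∑_{S∋i} p̂(S)²`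
   (`influence_eq_sum_sq_fourier`) the discharge follows by contradiction.

The exponent `3` on `Var` (the paper's route gives `2`) and the constant `2^{21d}` are immaterial for
the fact, which quantifies `∃ a C`.

## References

* [DinurEtAl2007] I. Dinur, E. Friedgut, G. Kindler, R. O'Donnell, *On the Fourier tails of bounded
  functions over the discrete cube*, Israel J. Math. 160 (2007) 389–412,
  doi:10.1007/s11856-007-0068-9 — Lemma 1.5 and its proof (§3, the polynomial `p_{x₀}(ρ) = T_ρ f(x₀)`,
  eq. (4)), Lemma 2.10 / Cor. 2.11–2.12 (coefficient extraction), Thm. 1.6 and its proof (§4, random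
  restriction, `γ_i`, Bonami–Beckner) (journal text read, pp. 4–5, 9–14).
* [ODonnell2014] R. O'Donnell, *Analysis of Boolean Functions*, CUP 2014 — §2.4 (noise operator),
  Prop. 3.21 (restrictions), Thm. 9.21 (Bonami), Ch. 8 notes (the DFKO bound).
* [AaronsonAmbainis2014] S. Aaronson, A. Ambainis, Theory of Computing 10 (2014) 133–166 — p. 6
  (the DFKO bound as the `2^{O(d)}`-lossy Aaronson–Ambainis conjecture).
-/

noncomputable section

namespace Literature.Computability.QuantumComplexity

namespace DFKO

open Finset Polynomial fwdDiff Literature.Computability.Complexity.LowDegree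
  Literature.Probability.RandomGraphs.LowDegree

variable {m : ℕ}

/-! ### The noise operator at a point as a polynomial in the noise rate -/

/-- The noise kernel expands over characters:
`∏_i (1 + s χ_i(x) χ_i(y)) = ∑_T s^{|T|} χ_T(x) χ_T(y)`. [folklore] -/
theorem prod_one_add_noise (s : ℝ) (x y : Fin m → Bool) :
    ∏ i, (1 + s * sgn (x i) * sgn (y i)) =
      ∑ T : Finset (Fin m), s ^ T.card * (walsh T x * walsh T y) := by
  rw [Finset.prod_one_add, Finset.powerset_univ]
  refine Finset.sum_congr rfl fun T _ => ?_
  rw [walsh, walsh, ← Finset.prod_mul_distrib, ← Finset.prod_const, ← Finset.prod_mul_distrib]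
  exact Finset.prod_congr rfl fun i _ => by ring

/-- **The noise operator at a point** (`T_s h(y) = ∑_T ĥ(T) s^{|T|} χ_T(y)`) **is an average of
`h`** against the kernel `2^{-m} ∏_i (1 + s χ_i(x) χ_i(y))`. [cite: ODonnell2014, §2.4] -/
theorem noiseSum_eq (h : (Fin m → Bool) → ℝ) (s : ℝ) (y : Fin m → Bool) :
    ∑ T : Finset (Fin m), cubeFourierCoeff h T * s ^ T.card * walsh T y =
      (∑ x, h x * ∏ i, (1 + s * sgn (x i) * sgn (y i))) / 2 ^ m := by
  simp_rw [prod_one_add_noise, Finset.mul_sum]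
  rw [Finset.sum_comm, Finset.sum_div]
  refine Finset.sum_congr rfl fun T _ => ?_
  rw [cubeFourierCoeff, Finset.sum_div, Finset.sum_mul, Finset.sum_mul, Finset.sum_div]
  exact Finset.sum_congr rfl fun x _ => by ring

/-- The noise kernel is nonnegative for `|s| ≤ 1`. [folklore] -/
theorem noiseKernel_nonneg {s : ℝ} (hs : |s| ≤ 1) (x y : Fin m → Bool) :
    0 ≤ ∏ i, (1 + s * sgn (x i) * sgn (y i)) :=
  Finset.prod_nonneg fun i _ => by
    have h1 : |s * sgn (x i) * sgn (y i)| ≤ 1 := by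
      rw [abs_mul, abs_mul]
      cases x i <;> cases y i <;> simpa [sgn] using hs
    linarith [neg_abs_le (s * sgn (x i) * sgn (y i))]

/-- The noise kernel has total mass `2^m`. [folklore] -/
theorem sum_noiseKernel (s : ℝ) (y : Fin m → Bool) :
    ∑ x : Fin m → Bool, ∏ i, (1 + s * sgn (x i) * sgn (y i)) = 2 ^ m := by
  have h := Finset.prod_univ_sum (fun _ : Fin m => (Finset.univ : Finset Bool))
    (fun i b => (1 + s * sgn b * sgn (y i)))
  rw [Fintype.piFinset_univ] at h
  rw [← h]
  have h2 : ∀ i : Fin m, ∑ b : Bool, (1 + s * sgn b * sgn (y i)) = 2 := fun i => by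
    rw [Fintype.sum_bool]; simp only [sgn_true, sgn_false]; ring
  simp_rw [h2]
  rw [Finset.prod_const, Finset.card_univ, Fintype.card_fin]

/-- **`T_s` is a contraction on `[0,1]`-valued functions**: for `0 ≤ h ≤ 1` and `|s| ≤ 1`,
`0 ≤ T_s h(y) ≤ 1`. [cite: ODonnell2014, §2.4] -/
theorem noiseSum_mem {h : (Fin m → Bool) → ℝ} (h0 : ∀ x, 0 ≤ h x) (h1 : ∀ x, h x ≤ 1)
    {s : ℝ} (hs : |s| ≤ 1) (y : Fin m → Bool) :
    0 ≤ ∑ T : Finset (Fin m), cubeFourierCoeff h T * s ^ T.card * walsh T y ∧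
      ∑ T : Finset (Fin m), cubeFourierCoeff h T * s ^ T.card * walsh T y ≤ 1 := by
  rw [noiseSum_eq]
  have hN : (0 : ℝ) < 2 ^ m := by positivity
  constructor
  · exact div_nonneg (Finset.sum_nonneg fun x _ => mul_nonneg (h0 x) (noiseKernel_nonneg hs x y))
      hN.le
  · rw [div_le_one hN]
    calc ∑ x, h x * ∏ i, (1 + s * sgn (x i) * sgn (y i))
        ≤ ∑ x : Fin m → Bool, ∏ i, (1 + s * sgn (x i) * sgn (y i)) :=
          Finset.sum_le_sum fun x _ =>
            (mul_le_of_le_one_left (noiseKernel_nonneg hs x y) (h1 x))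
      _ = 2 ^ m := sum_noiseKernel s y

/-! ### The linear part of a bounded low-degree function is bounded (sup-norm form of DFKO, Cor. 2.12) -/

/-- **Linear coefficient extraction** (in place of the Chebyshev extremal property, DFKO Lemma 2.10 /
Cor. 2.11–2.12): if `P ∈ ℝ[X]` has degree `≤ d`, `d ≥ 1`, and `0 ≤ P(k) ≤ 1` for
`k = 0, 1, …, d`, then `|P.coeff 1| ≤ 2^d` (the `d`-th forward difference of `(P - P(0))/X`, a
polynomial of degree `< d`, vanishes). [cite: DinurEtAl2007, Lemma 2.10 and Cor. 2.12 (role)] -/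
theorem abs_coeff_one_le {P : ℝ[X]} {d : ℕ} (hd : 1 ≤ d) (hdeg : P.natDegree ≤ d)
    (hval : ∀ k : ℕ, k ≤ d → 0 ≤ P.eval (k : ℝ) ∧ P.eval (k : ℝ) ≤ 1) :
    |P.coeff 1| ≤ 2 ^ d := by
  set Q : ℝ[X] := P.divX with hQ_def
  have hQdeg : Q.natDegree < d := by
    rw [hQ_def, natDegree_divX_eq_natDegree_tsub_one]; omega
  -- the `d`-th forward difference of `Q` at `0` vanishes
  have hz : (Δ_[(1 : ℝ)]^[d] fun x => eval x Q) 0 = 0 := by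
    rw [Polynomial.fwdDiff_iter_eq_zero_of_degree_lt hQdeg]; rfl
  rw [fwdDiff_iter_eq_sum_shift, Finset.sum_range_succ'] at hz
  simp only [zero_add, nsmul_eq_mul, mul_one, Nat.cast_zero, Nat.sub_zero,
    Nat.choose_zero_right, Nat.cast_one, zsmul_eq_mul, Int.cast_mul, Int.cast_pow, Int.cast_neg,
    Int.cast_one, Int.cast_natCast] at hz
  -- `Q(0) = P.coeff 1`
  have hQ0 : eval (0 : ℝ) Q = P.coeff 1 := by
    rw [← Polynomial.coeff_zero_eq_eval_zero, hQ_def, coeff_divX]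
  -- `Q(k) k = P(k) - P(0)`
  have hQk : ∀ k : ℕ, eval (k : ℝ) Q * k = P.eval (k : ℝ) - P.eval 0 := by
    intro k
    have h := congrArg (Polynomial.eval (k : ℝ)) (Polynomial.divX_mul_X_add P)
    rw [eval_add, eval_mul, eval_X, eval_C, Polynomial.coeff_zero_eq_eval_zero] at h
    rw [← hQ_def] at h
    linarith
  -- hence `|Q(k)| ≤ 1` for `1 ≤ k ≤ d`
  have hQb : ∀ k : ℕ, 1 ≤ k → k ≤ d → |eval (k : ℝ) Q| ≤ 1 := by
    intro k hk1 hkd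
    have hk : (1 : ℝ) ≤ k := by exact_mod_cast hk1
    have h0 := hval 0 (Nat.zero_le _)
    have hkv := hval k hkd
    rw [Nat.cast_zero] at h0
    have hprod : |eval (k : ℝ) Q * k| ≤ 1 := by
      rw [hQk k, abs_le]; constructor <;> linarith [h0.1, h0.2, hkv.1, hkv.2]
    rw [abs_mul, abs_of_pos (by linarith : (0 : ℝ) < k)] at hprod
    calc |eval (k : ℝ) Q| = |eval (k : ℝ) Q| * 1 := (mul_one _).symm
      _ ≤ |eval (k : ℝ) Q| * k := mul_le_mul_of_nonneg_left hk (abs_nonneg _)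
      _ ≤ 1 := hprod
  -- isolate the `k = 0` term
  have hiso : (-1 : ℝ) ^ d * P.coeff 1 =
      -∑ k ∈ Finset.range d, (-1 : ℝ) ^ (d - (k + 1)) * (d.choose (k + 1) : ℝ) *
        eval ((k + 1 : ℕ) : ℝ) Q := by
    rw [← hQ0]
    linarith
  have habs : |P.coeff 1| = |(-1 : ℝ) ^ d * P.coeff 1| := by
    rw [abs_mul, abs_pow, abs_neg, abs_one, one_pow, one_mul]
  rw [habs, hiso, abs_neg]
  calc |∑ k ∈ Finset.range d, (-1 : ℝ) ^ (d - (k + 1)) * (d.choose (k + 1) : ℝ) *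
          eval ((k + 1 : ℕ) : ℝ) Q|
      ≤ ∑ k ∈ Finset.range d, |(-1 : ℝ) ^ (d - (k + 1)) * (d.choose (k + 1) : ℝ) *
          eval ((k + 1 : ℕ) : ℝ) Q| := Finset.abs_sum_le_sum_abs _ _
    _ ≤ ∑ k ∈ Finset.range d, (d.choose (k + 1) : ℝ) := by
        refine Finset.sum_le_sum fun k hk => ?_
        have hkd : k + 1 ≤ d := Nat.succ_le_of_lt (Finset.mem_range.1 hk)
        rw [abs_mul, abs_mul, abs_pow, abs_neg, abs_one, one_pow, one_mul, Nat.abs_cast]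
        calc (d.choose (k + 1) : ℝ) * |eval ((k + 1 : ℕ) : ℝ) Q|
            ≤ (d.choose (k + 1) : ℝ) * 1 :=
              mul_le_mul_of_nonneg_left (hQb (k + 1) (Nat.succ_pos k) hkd) (Nat.cast_nonneg _)
          _ = _ := mul_one _
    _ ≤ ∑ k ∈ Finset.range (d + 1), (d.choose k : ℝ) := by
        rw [Finset.sum_range_succ']
        simp only [Nat.choose_zero_right, Nat.cast_one]
        linarith
    _ = 2 ^ d := by
        rw [← Nat.cast_sum, Nat.sum_range_choose]; push_cast; ring

/-- The polynomial `P_y(X) = ∑_T ĥ(T) χ_T(y) d^{-|T|} X^{|T|}`, with `P_y(k) = T_{k/d} h(y)`.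
[cite: DinurEtAl2007, §3 (the polynomial `p_{x₀}(ρ) = T_ρ f(x₀)`)] -/
theorem eval_noisePoly (h : (Fin m → Bool) → ℝ) (y : Fin m → Bool) (d : ℕ) (r : ℝ) :
    (∑ T : Finset (Fin m), C (cubeFourierCoeff h T * walsh T y / (d : ℝ) ^ T.card) * X ^ T.card).eval r =
      ∑ T : Finset (Fin m), cubeFourierCoeff h T * (r / d) ^ T.card * walsh T y := by
  rw [eval_finsetSum]
  refine Finset.sum_congr rfl fun T _ => ?_
  rw [eval_mul, eval_C, eval_pow, eval_X, div_pow]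
  ring

/-- The noise polynomial has degree `≤ d` when `h` does. [folklore] -/
theorem natDegree_noisePoly_le {h : (Fin m → Bool) → ℝ} (y : Fin m → Bool) {d : ℕ}
    (hdeg : ∀ S : Finset (Fin m), d < S.card → cubeFourierCoeff h S = 0) :
    (∑ T : Finset (Fin m), C (cubeFourierCoeff h T * walsh T y / (d : ℝ) ^ T.card) * X ^ T.card).natDegree
      ≤ d := by
  refine natDegree_sum_le_of_forall_le _ _ fun T _ => ?_
  by_cases hT : d < T.card
  · rw [hdeg T hT, zero_mul, zero_div, C_0, zero_mul]; exact Nat.zero_le _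
  · exact (natDegree_C_mul_X_pow_le _ _).trans (not_lt.1 hT)

/-- The linear coefficient of the noise polynomial is `d^{-1} ∑_i ĥ({i}) χ_i(y)`.
[cite: DinurEtAl2007, §3 ("the linear coefficient of `p_{x₀}` is precisely `ℓ(x₀)`")] -/
theorem coeff_one_noisePoly (h : (Fin m → Bool) → ℝ) (y : Fin m → Bool) (d : ℕ) :
    (∑ T : Finset (Fin m), C (cubeFourierCoeff h T * walsh T y / (d : ℝ) ^ T.card) * X ^ T.card).coeff 1 =
      (∑ i, cubeFourierCoeff h {i} * sgn (y i)) / d := by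
  rw [finsetSum_coeff]
  simp_rw [coeff_C_mul_X_pow]
  rw [← Finset.sum_filter]
  have hfilter : (Finset.univ.filter fun T : Finset (Fin m) => 1 = T.card) =
      Finset.powersetCard 1 (Finset.univ : Finset (Fin m)) := by
    ext T
    simp only [Finset.mem_filter, Finset.mem_univ, true_and, Finset.mem_powersetCard,
      Finset.subset_univ, eq_comm]
  rw [hfilter, Finset.powersetCard_one, Finset.sum_map, Finset.sum_div]
  refine Finset.sum_congr rfl fun i _ => ?_
  simp only [Function.Embedding.coeFn_mk, Finset.card_singleton, pow_one, walsh,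
    Finset.prod_singleton]

/-- **The linear part of a `[0,1]`-valued function of degree `≤ d` is bounded by `d 2^d`**
(sup-norm form of DFKO Lemma 1.5 / Cor. 2.12: `p_y(s) = T_s h(y)` is a polynomial of degree `≤ d`
in the noise rate `s` with linear coefficient `∑_i ĥ({i}) χ_i(y)` and values in `[0,1]` for
`|s| ≤ 1`). [cite: DinurEtAl2007, §3 proof of Lemma 1.5 (eq. (4))] -/
theorem abs_sum_fourier_singleton_mul_sgn_le {h : (Fin m → Bool) → ℝ} (h0 : ∀ x, 0 ≤ h x)
    (h1 : ∀ x, h x ≤ 1) {d : ℕ} (hd : 1 ≤ d)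
    (hdeg : ∀ S : Finset (Fin m), d < S.card → cubeFourierCoeff h S = 0) (y : Fin m → Bool) :
    |∑ i, cubeFourierCoeff h {i} * sgn (y i)| ≤ d * 2 ^ d := by
  have hdpos : (0 : ℝ) < d := by exact_mod_cast hd
  -- values at `k = 0, …, d`
  have hval : ∀ k : ℕ, k ≤ d →
      0 ≤ (∑ T : Finset (Fin m), C (cubeFourierCoeff h T * walsh T y / (d : ℝ) ^ T.card) *
        X ^ T.card).eval (k : ℝ) ∧
      (∑ T : Finset (Fin m), C (cubeFourierCoeff h T * walsh T y / (d : ℝ) ^ T.card) *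
        X ^ T.card).eval (k : ℝ) ≤ 1 := by
    intro k hk
    rw [eval_noisePoly]
    refine noiseSum_mem h0 h1 ?_ y
    rw [abs_div, Nat.abs_cast, Nat.abs_cast, div_le_one hdpos]
    exact_mod_cast hk
  have hc := abs_coeff_one_le hd (natDegree_noisePoly_le y hdeg) hval
  rw [coeff_one_noisePoly, abs_div, Nat.abs_cast, div_le_iff₀ hdpos] at hc
  calc |∑ i, cubeFourierCoeff h {i} * sgn (y i)| ≤ 2 ^ d * d := hc
    _ = d * 2 ^ d := mul_comm _ _

/-- **The level-1 spectral norm of a `[0,1]`-valued function of degree `≤ d` is at most `d 2^d`.**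
[cite: DinurEtAl2007, §3 (Lemma 1.5 in sup-norm form)] -/
theorem sum_abs_fourier_singleton_le {h : (Fin m → Bool) → ℝ} (h0 : ∀ x, 0 ≤ h x)
    (h1 : ∀ x, h x ≤ 1) {d : ℕ} (hd : 1 ≤ d)
    (hdeg : ∀ S : Finset (Fin m), d < S.card → cubeFourierCoeff h S = 0) :
    ∑ i, |cubeFourierCoeff h {i}| ≤ d * 2 ^ d := by
  set y : Fin m → Bool := fun i => decide (cubeFourierCoeff h {i} < 0) with hy
  have key : ∀ i, cubeFourierCoeff h {i} * sgn (y i) = |cubeFourierCoeff h {i}| := by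
    intro i
    by_cases hc : cubeFourierCoeff h {i} < 0
    · simp [hy, hc, sgn, abs_of_neg hc]
    · simp [hy, hc, sgn, abs_of_nonneg (not_lt.1 hc)]
  have hc := abs_sum_fourier_singleton_mul_sgn_le h0 h1 hd hdeg y
  simp_rw [key] at hc
  rwa [abs_of_nonneg (Finset.sum_nonneg fun i _ => abs_nonneg _)] at hc


/-! ### From the spectral-norm bound to the level-1 weight -/

/-- `c² ≤ θ|c| + c⁴/θ²` for `θ > 0` (cases `|c| ≤ θ`, `|c| > θ`). [folklore] -/
theorem sq_le_mul_abs_add (c : ℝ) {θ : ℝ} (hθ : 0 < θ) :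
    c ^ 2 ≤ θ * |c| + (c ^ 2) ^ 2 / θ ^ 2 := by
  have h4 : 0 ≤ (c ^ 2) ^ 2 / θ ^ 2 := by positivity
  rcases le_or_gt |c| θ with hc | hc
  · calc c ^ 2 = |c| * |c| := by rw [← sq_abs, sq]
      _ ≤ θ * |c| := mul_le_mul_of_nonneg_right hc (abs_nonneg c)
      _ ≤ θ * |c| + (c ^ 2) ^ 2 / θ ^ 2 := le_add_of_nonneg_right h4
  · have hθc : θ ^ 2 ≤ c ^ 2 := by
      rw [← sq_abs c]; exact pow_le_pow_left₀ hθ.le hc.le 2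
    have h1 : c ^ 2 ≤ (c ^ 2) ^ 2 / θ ^ 2 := by
      rw [le_div_iff₀ (pow_pos hθ 2), sq (c ^ 2)]
      exact mul_le_mul_of_nonneg_left hθc (sq_nonneg c)
    have h2 : 0 ≤ θ * |c| := mul_nonneg hθ.le (abs_nonneg c)
    linarith

/-- **Level-1 weight of a `[0,1]`-valued function of degree `≤ d`**: for every `θ > 0`,
`∑_i ĥ({i})² ≤ d 2^d θ + θ^{-2} ∑_i ĥ({i})⁴`. [cite: DinurEtAl2007, §3–4 (role of Lemma 4.1)] -/
theorem sum_sq_fourier_singleton_le {h : (Fin m → Bool) → ℝ} (h0 : ∀ x, 0 ≤ h x)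
    (h1 : ∀ x, h x ≤ 1) {d : ℕ} (hd : 1 ≤ d)
    (hdeg : ∀ S : Finset (Fin m), d < S.card → cubeFourierCoeff h S = 0) {θ : ℝ} (hθ : 0 < θ) :
    ∑ i, cubeFourierCoeff h {i} ^ 2 ≤
      d * 2 ^ d * θ + (∑ i, (cubeFourierCoeff h {i} ^ 2) ^ 2) / θ ^ 2 := by
  calc ∑ i, cubeFourierCoeff h {i} ^ 2
      ≤ ∑ i, (θ * |cubeFourierCoeff h {i}| + (cubeFourierCoeff h {i} ^ 2) ^ 2 / θ ^ 2) :=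
        Finset.sum_le_sum fun i _ => sq_le_mul_abs_add _ hθ
    _ = θ * ∑ i, |cubeFourierCoeff h {i}| + (∑ i, (cubeFourierCoeff h {i} ^ 2) ^ 2) / θ ^ 2 := by
        rw [Finset.sum_add_distrib, Finset.mul_sum, Finset.sum_div]
    _ ≤ θ * (d * 2 ^ d) + (∑ i, (cubeFourierCoeff h {i} ^ 2) ^ 2) / θ ^ 2 := by
        have := sum_abs_fourier_singleton_le h0 h1 hd hdeg
        nlinarith
    _ = d * 2 ^ d * θ + (∑ i, (cubeFourierCoeff h {i} ^ 2) ^ 2) / θ ^ 2 := by ring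

/-! ### Restrictions: degree, level-1 weight on average, fourth moments (DFKO §4) -/

/-- A restriction of a function of degree `≤ d` has degree `≤ d`. [cite: ODonnell2014, Prop. 3.21] -/
theorem cubeFourierCoeff_piecewise_eq_zero_of_lt (g : (Fin m → Bool) → ℝ) (A : Finset (Fin m))
    (β : Fin m → Bool) {d : ℕ} (hdeg : ∀ S : Finset (Fin m), d < S.card → cubeFourierCoeff g S = 0)
    {T : Finset (Fin m)} (hT : d < T.card) :
    cubeFourierCoeff (fun x => g (A.piecewise β x)) T = 0 := by
  rw [cubeFourierCoeff_piecewise]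
  refine Finset.sum_eq_zero fun S _ => ?_
  split_ifs with hS
  · have hTS : T.card ≤ S.card := by rw [← hS]; exact Finset.card_filter_le _ _
    rw [hdeg S (lt_of_lt_of_le hT hTS), zero_mul]
  · rfl

/-- `∑_i ĥ({i})² = W^{≥1}[h] - W^{≥2}[h]`. [folklore] -/
theorem sum_sq_fourier_singleton_eq (h : (Fin m → Bool) → ℝ) :
    ∑ i, cubeFourierCoeff h {i} ^ 2 = tailWeight h 1 - tailWeight h 2 := by
  unfold tailWeight
  rw [← Finset.sum_filter_add_sum_filter_not (Finset.univ.filter fun S : Finset (Fin m) => 1 ≤ S.card)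
    (fun S : Finset (Fin m) => 2 ≤ S.card), Finset.filter_filter, Finset.filter_filter]
  have e1 : (Finset.univ.filter fun S : Finset (Fin m) => 1 ≤ S.card ∧ 2 ≤ S.card) =
      Finset.univ.filter fun S : Finset (Fin m) => 2 ≤ S.card := by
    ext S; simp only [Finset.mem_filter, Finset.mem_univ, true_and]; omega
  have e2 : (Finset.univ.filter fun S : Finset (Fin m) => 1 ≤ S.card ∧ ¬ 2 ≤ S.card) =
      Finset.powersetCard 1 (Finset.univ : Finset (Fin m)) := by
    ext S
    simp only [Finset.mem_filter, Finset.mem_univ, true_and, Finset.mem_powersetCard,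
      Finset.subset_univ]
    omega
  rw [e1, e2, add_sub_cancel_left, Finset.powersetCard_one, Finset.sum_map]
  rfl

/-- The same split for the sets `S` with `|S ∖ A| = 1`. [folklore] -/
theorem sum_filter_card_sdiff_eq_one (A : Finset (Fin m)) (F : Finset (Fin m) → ℝ) :
    ∑ S ∈ Finset.univ.filter (fun S : Finset (Fin m) => (S \ A).card = 1), F S =
      ∑ S ∈ Finset.univ.filter (fun S : Finset (Fin m) => 1 ≤ (S \ A).card), F S -
        ∑ S ∈ Finset.univ.filter (fun S : Finset (Fin m) => 2 ≤ (S \ A).card), F S := by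
  rw [← Finset.sum_filter_add_sum_filter_not
    (Finset.univ.filter fun S : Finset (Fin m) => 1 ≤ (S \ A).card)
    (fun S : Finset (Fin m) => 2 ≤ (S \ A).card), Finset.filter_filter, Finset.filter_filter]
  have e1 : (Finset.univ.filter fun S : Finset (Fin m) => 1 ≤ (S \ A).card ∧ 2 ≤ (S \ A).card) =
      Finset.univ.filter fun S : Finset (Fin m) => 2 ≤ (S \ A).card := by
    ext S; simp only [Finset.mem_filter, Finset.mem_univ, true_and]; omega
  have e2 : (Finset.univ.filter fun S : Finset (Fin m) => 1 ≤ (S \ A).card ∧ ¬ 2 ≤ (S \ A).card) =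
      Finset.univ.filter fun S : Finset (Fin m) => (S \ A).card = 1 := by
    ext S; simp only [Finset.mem_filter, Finset.mem_univ, true_and]; omega
  rw [e1, e2, add_sub_cancel_left]

/-- **Average level-1 weight of the restrictions**: `2^{-m} ∑_β ∑_i ĝ_{A←β}({i})² = ∑_{|S∖A|=1} ĝ(S)²`
(DFKO §4: `E[γ_i]`, summed). [cite: DinurEtAl2007, §4 (the quantities `γ_i`)] -/
theorem sum_sum_sq_fourier_singleton_piecewise (g : (Fin m → Bool) → ℝ) (A : Finset (Fin m)) :
    ∑ β : Fin m → Bool, ∑ i, cubeFourierCoeff (fun x => g (A.piecewise β x)) {i} ^ 2 =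
      2 ^ m * ∑ S ∈ Finset.univ.filter (fun S : Finset (Fin m) => (S \ A).card = 1),
        cubeFourierCoeff g S ^ 2 := by
  simp_rw [sum_sq_fourier_singleton_eq]
  rw [Finset.sum_sub_distrib, sum_tailWeight_piecewise, sum_tailWeight_piecewise, ← mul_sub,
    sum_filter_card_sdiff_eq_one]

/-- **Fourth moment of a restricted level-1 coefficient** (DFKO §4, "we can control the amount by
which the coefficients deviate from their expectation using Bonami–Beckner"): for `g` of degree
`≤ d`, `2^{-m} ∑_β ĝ_{A←β}({i})⁴ ≤ 9^{d-1} (∑_{S∋i} ĝ(S)²)²`, since `β ↦ ĝ_{A←β}({i})` is the Walsh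
sum `∑_{U⊆A} ĝ({i}∪U) χ_U(β)` of degree `≤ d - 1`. [cite: DinurEtAl2007, §4] -/
theorem sum_fourier_singleton_piecewise_pow_four_le (g : (Fin m → Bool) → ℝ) (A : Finset (Fin m))
    {d : ℕ} (hdeg : ∀ S : Finset (Fin m), d < S.card → cubeFourierCoeff g S = 0) (i : Fin m) :
    (∑ β : Fin m → Bool, (cubeFourierCoeff (fun x => g (A.piecewise β x)) {i} ^ 2) ^ 2) / 2 ^ m ≤
      (9 : ℝ) ^ (d - 1) *
        (∑ S ∈ Finset.univ.filter (fun S : Finset (Fin m) => i ∈ S), cubeFourierCoeff g S ^ 2) ^ 2 := by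
  by_cases hiA : i ∈ A
  · have hz : ∀ β : Fin m → Bool, cubeFourierCoeff (fun x => g (A.piecewise β x)) {i} = 0 :=
      fun β => cubeFourierCoeff_piecewise_eq_zero g A β ⟨i, Finset.mem_singleton_self i, hiA⟩
    simp only [hz]
    norm_num
    positivity
  -- the Walsh sum `H(β) = ∑_U c(U) χ_U(β)`
  set c : Finset (Fin m) → ℝ := fun U => if U ⊆ A then cubeFourierCoeff g ({i} ∪ U) else 0
    with hc_def
  have hH : ∀ β : Fin m → Bool, cubeFourierCoeff (fun x => g (A.piecewise β x)) {i} =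
      ∑ U, c U * walsh U β := by
    intro β
    rw [cubeFourierCoeff_piecewise_eq_sum_powerset g A β (Finset.disjoint_singleton_left.2 hiA),
      ← Finset.filter_subset_univ, Finset.sum_filter]
    refine Finset.sum_congr rfl fun U _ => ?_
    simp only [hc_def]
    split_ifs <;> simp
  simp_rw [hH]
  -- its coefficients and degree
  have hcoef : ∀ U, cubeFourierCoeff (fun β => ∑ U, c U * walsh U β) U = c U :=
    cubeFourierCoeff_sum_mul_walsh c
  have hdegH : ∀ U : Finset (Fin m), d - 1 < U.card →
      cubeFourierCoeff (fun β => ∑ U, c U * walsh U β) U = 0 := by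
    intro U hU
    rw [hcoef, hc_def]
    simp only
    split_ifs with hUA
    · have hiU : i ∉ U := fun h => hiA (hUA h)
      refine hdeg _ ?_
      rw [← Finset.insert_eq, Finset.card_insert_of_notMem hiU]
      omega
    · rfl
  -- Bonami with `r = 2`
  have hB := bonami_even_moment (d - 1) (fun β => ∑ U, c U * walsh U β) hdegH 2 (by norm_num)
  -- Parseval
  have hP : (∑ β : Fin m → Bool, (∑ U, c U * walsh U β) ^ 2) / 2 ^ m = ∑ U, c U ^ 2 := by
    rw [← sum_cubeFourierCoeff_sq]
    exact Finset.sum_congr rfl fun U _ => by rw [hcoef]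
  rw [hP] at hB
  -- `∑_U c(U)² ≤ ∑_{S∋i} ĝ(S)²`
  have hcle : ∑ U, c U ^ 2 ≤
      ∑ S ∈ Finset.univ.filter (fun S : Finset (Fin m) => i ∈ S), cubeFourierCoeff g S ^ 2 := by
    have e : ∑ U, c U ^ 2 = ∑ U ∈ A.powerset, cubeFourierCoeff g ({i} ∪ U) ^ 2 := by
      rw [← Finset.filter_subset_univ, Finset.sum_filter]
      refine Finset.sum_congr rfl fun U _ => ?_
      simp only [hc_def]
      split_ifs <;> simp
    rw [e]
    have hinj : Set.InjOn (fun U : Finset (Fin m) => {i} ∪ U) ↑(A.powerset) := by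
      intro U₁ hU₁ U₂ hU₂ hU
      simp only [Finset.coe_powerset, Set.mem_preimage, Set.mem_powerset_iff,
        Finset.coe_subset] at hU₁ hU₂
      have h1 : i ∉ U₁ := fun h => hiA (hU₁ h)
      have h2 : i ∉ U₂ := fun h => hiA (hU₂ h)
      have := congrArg (fun S : Finset (Fin m) => S.erase i) hU
      simp only [← Finset.insert_eq, Finset.erase_insert h1, Finset.erase_insert h2] at this
      exact this
    rw [← Finset.sum_image (g := fun U : Finset (Fin m) => {i} ∪ U)
      (f := fun S => cubeFourierCoeff g S ^ 2) hinj]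
    refine Finset.sum_le_sum_of_subset_of_nonneg ?_ fun S _ _ => sq_nonneg _
    intro S hS
    simp only [Finset.mem_image, Finset.mem_powerset] at hS
    obtain ⟨U, _, rfl⟩ := hS
    simp
  have hc0 : 0 ≤ ∑ U, c U ^ 2 := Finset.sum_nonneg fun U _ => sq_nonneg _
  calc (∑ β : Fin m → Bool, ((∑ U, c U * walsh U β) ^ 2) ^ 2) / 2 ^ m
      ≤ (2 * (2 : ℕ) - 1 : ℝ) ^ (2 * (d - 1)) * (∑ U, c U ^ 2) ^ 2 := hB
    _ = (9 : ℝ) ^ (d - 1) * (∑ U, c U ^ 2) ^ 2 := by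
        rw [pow_mul]; norm_num
    _ ≤ (9 : ℝ) ^ (d - 1) *
        (∑ S ∈ Finset.univ.filter (fun S : Finset (Fin m) => i ∈ S), cubeFourierCoeff g S ^ 2) ^ 2 :=
        mul_le_mul_of_nonneg_left (pow_le_pow_left₀ hc0 hcle 2) (by positivity)

/-- **Total influence of a bounded degree-`d` function**: `∑_i ∑_{S∋i} ĝ(S)² = ∑_S |S| ĝ(S)² ≤ d`
for `|g| ≤ 1` of degree `≤ d`. [cite: ODonnell2014, §2.2 (total influence)] -/
theorem sum_sum_sq_fourier_mem_le {g : (Fin m → Bool) → ℝ} (h0 : ∀ x, 0 ≤ g x) (h1 : ∀ x, g x ≤ 1)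
    {d : ℕ} (hdeg : ∀ S : Finset (Fin m), d < S.card → cubeFourierCoeff g S = 0) :
    ∑ i, ∑ S ∈ Finset.univ.filter (fun S : Finset (Fin m) => i ∈ S), cubeFourierCoeff g S ^ 2 ≤ d := by
  have hsw : ∑ i, ∑ S ∈ Finset.univ.filter (fun S : Finset (Fin m) => i ∈ S), cubeFourierCoeff g S ^ 2 =
      ∑ S : Finset (Fin m), (S.card : ℝ) * cubeFourierCoeff g S ^ 2 := by
    simp_rw [Finset.sum_filter]
    rw [Finset.sum_comm]
    refine Finset.sum_congr rfl fun S _ => ?_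
    rw [Finset.sum_ite, Finset.sum_const_zero, add_zero, Finset.sum_const, nsmul_eq_mul]
    congr 2
    simp
  rw [hsw]
  have hle : ∀ S : Finset (Fin m), (S.card : ℝ) * cubeFourierCoeff g S ^ 2 ≤ d * cubeFourierCoeff g S ^ 2 := by
    intro S
    by_cases hS : d < S.card
    · rw [hdeg S hS]; simp
    · exact mul_le_mul_of_nonneg_right (by exact_mod_cast not_lt.1 hS) (sq_nonneg _)
  have hpar : ∑ S, cubeFourierCoeff g S ^ 2 ≤ 1 := by
    rw [sum_cubeFourierCoeff_sq, div_le_one (by positivity)]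
    calc ∑ x, g x ^ 2 ≤ ∑ _x : Fin m → Bool, (1 : ℝ) :=
          Finset.sum_le_sum fun x _ => by
            have := h0 x; have := h1 x; nlinarith
      _ = 2 ^ m := by simp
  calc ∑ S : Finset (Fin m), (S.card : ℝ) * cubeFourierCoeff g S ^ 2
      ≤ ∑ S : Finset (Fin m), (d : ℝ) * cubeFourierCoeff g S ^ 2 := Finset.sum_le_sum fun S _ => hle S
    _ = d * ∑ S, cubeFourierCoeff g S ^ 2 := by rw [Finset.mul_sum]
    _ ≤ d * 1 := mul_le_mul_of_nonneg_left hpar (Nat.cast_nonneg _)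
    _ = d := mul_one _

/-- **The level-1 weight of a random restriction is small when all influences are small**: for
`g : {0,1}^m → [0,1]` of degree `≤ d` with `∑_{S∋i} ĝ(S)² ≤ t` for all `i`, every `A` and every
`θ > 0`, `∑_{|S∖A|=1} ĝ(S)² ≤ d 2^d θ + 9^{d-1} d t / θ²`. [cite: DinurEtAl2007, §4] -/
theorem sum_filter_card_sdiff_eq_one_le {g : (Fin m → Bool) → ℝ} (h0 : ∀ x, 0 ≤ g x)
    (h1 : ∀ x, g x ≤ 1) {d : ℕ} (hd : 1 ≤ d)
    (hdeg : ∀ S : Finset (Fin m), d < S.card → cubeFourierCoeff g S = 0) {t : ℝ} (ht : 0 ≤ t)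
    (hI : ∀ i, ∑ S ∈ Finset.univ.filter (fun S : Finset (Fin m) => i ∈ S), cubeFourierCoeff g S ^ 2 ≤ t)
    (A : Finset (Fin m)) {θ : ℝ} (hθ : 0 < θ) :
    ∑ S ∈ Finset.univ.filter (fun S : Finset (Fin m) => (S \ A).card = 1), cubeFourierCoeff g S ^ 2 ≤
      d * 2 ^ d * θ + (9 : ℝ) ^ (d - 1) * d * t / θ ^ 2 := by
  have hN : (0 : ℝ) < 2 ^ m := by positivity
  -- per restriction
  have hβ : ∀ β : Fin m → Bool, ∑ i, cubeFourierCoeff (fun x => g (A.piecewise β x)) {i} ^ 2 ≤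
      d * 2 ^ d * θ + (∑ i, (cubeFourierCoeff (fun x => g (A.piecewise β x)) {i} ^ 2) ^ 2) / θ ^ 2 :=
    fun β => sum_sq_fourier_singleton_le (fun x => h0 _) (fun x => h1 _) hd
      (fun S hS => cubeFourierCoeff_piecewise_eq_zero_of_lt g A β hdeg hS) hθ
  -- fourth moments
  have h4 : ∑ β : Fin m → Bool, ∑ i, (cubeFourierCoeff (fun x => g (A.piecewise β x)) {i} ^ 2) ^ 2 ≤
      2 ^ m * ((9 : ℝ) ^ (d - 1) * d * t) := by
    rw [Finset.sum_comm]
    have hi : ∀ i : Fin m, ∑ β : Fin m → Bool, (cubeFourierCoeff (fun x => g (A.piecewise β x)) {i} ^ 2) ^ 2 ≤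
        2 ^ m * ((9 : ℝ) ^ (d - 1) * (t *
          ∑ S ∈ Finset.univ.filter (fun S : Finset (Fin m) => i ∈ S), cubeFourierCoeff g S ^ 2)) := by
      intro i
      have h := sum_fourier_singleton_piecewise_pow_four_le g A hdeg i
      rw [div_le_iff₀ hN] at h
      have hIi0 : 0 ≤ ∑ S ∈ Finset.univ.filter (fun S : Finset (Fin m) => i ∈ S), cubeFourierCoeff g S ^ 2 :=
        Finset.sum_nonneg fun S _ => sq_nonneg _
      calc _ ≤ (9 : ℝ) ^ (d - 1) *
            (∑ S ∈ Finset.univ.filter (fun S : Finset (Fin m) => i ∈ S), cubeFourierCoeff g S ^ 2) ^ 2 *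
            2 ^ m := h
        _ ≤ (9 : ℝ) ^ (d - 1) *
            (t * ∑ S ∈ Finset.univ.filter (fun S : Finset (Fin m) => i ∈ S), cubeFourierCoeff g S ^ 2) *
            2 ^ m := by
            refine mul_le_mul_of_nonneg_right (mul_le_mul_of_nonneg_left ?_ (by positivity)) hN.le
            rw [sq]
            exact mul_le_mul_of_nonneg_right (hI i) hIi0
        _ = _ := by ring
    calc _ ≤ ∑ i : Fin m, 2 ^ m * ((9 : ℝ) ^ (d - 1) * (t *
          ∑ S ∈ Finset.univ.filter (fun S : Finset (Fin m) => i ∈ S), cubeFourierCoeff g S ^ 2)) :=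
          Finset.sum_le_sum fun i _ => hi i
      _ = 2 ^ m * ((9 : ℝ) ^ (d - 1) * (t *
          ∑ i, ∑ S ∈ Finset.univ.filter (fun S : Finset (Fin m) => i ∈ S), cubeFourierCoeff g S ^ 2)) := by
          rw [← Finset.mul_sum, ← Finset.mul_sum, ← Finset.mul_sum]
      _ ≤ 2 ^ m * ((9 : ℝ) ^ (d - 1) * (t * d)) := by
          have := sum_sum_sq_fourier_mem_le h0 h1 hdeg
          gcongr
      _ = _ := by ring
  -- average over `β`
  have hsum := sum_sum_sq_fourier_singleton_piecewise g A
  have htot : ∑ β : Fin m → Bool, ∑ i, cubeFourierCoeff (fun x => g (A.piecewise β x)) {i} ^ 2 ≤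
      2 ^ m * (d * 2 ^ d * θ) + 2 ^ m * ((9 : ℝ) ^ (d - 1) * d * t) / θ ^ 2 := by
    calc _ ≤ ∑ β : Fin m → Bool, (d * 2 ^ d * θ +
          (∑ i, (cubeFourierCoeff (fun x => g (A.piecewise β x)) {i} ^ 2) ^ 2) / θ ^ 2) :=
          Finset.sum_le_sum fun β _ => hβ β
      _ = 2 ^ m * (d * 2 ^ d * θ) +
          (∑ β : Fin m → Bool, ∑ i, (cubeFourierCoeff (fun x => g (A.piecewise β x)) {i} ^ 2) ^ 2) / θ ^ 2 := by
          rw [Finset.sum_add_distrib, Finset.sum_const, Finset.card_univ, Fintype.card_fun,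
            Fintype.card_bool, Fintype.card_fin, nsmul_eq_mul, Finset.sum_div]
          push_cast
          ring
      _ ≤ _ := by
          have hθ2 : 0 < θ ^ 2 := pow_pos hθ 2
          exact add_le_add le_rfl (div_le_div_of_nonneg_right h4 hθ2.le)
  rw [hsum] at htot
  have hθ2 : 0 < θ ^ 2 := pow_pos hθ 2
  have key : 2 ^ m * ∑ S ∈ Finset.univ.filter (fun S : Finset (Fin m) => (S \ A).card = 1),
      cubeFourierCoeff g S ^ 2 ≤ 2 ^ m * (d * 2 ^ d * θ + (9 : ℝ) ^ (d - 1) * d * t / θ ^ 2) := by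
    calc _ ≤ 2 ^ m * (d * 2 ^ d * θ) + 2 ^ m * ((9 : ℝ) ^ (d - 1) * d * t) / θ ^ 2 := htot
      _ = _ := by field_simp
  exact le_of_mul_le_mul_left key hN


/-! ### Averaging over the random set of fixed coordinates (DFKO §4, `Pr[S ∩ U = {i}]`) -/

/-- For a natural number `X`, `2X - X² ≤ [X = 1]`. [folklore] -/
theorem two_mul_sub_sq_le_ite (X : ℕ) :
    2 * (X : ℝ) - (X : ℝ) ^ 2 ≤ if X = 1 then 1 else 0 := by
  rcases Nat.lt_or_ge X 2 with h | h
  · interval_cases X <;> norm_num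
  · have hX : (2 : ℝ) ≤ X := by exact_mod_cast h
    rw [if_neg (by omega)]
    nlinarith

/-- **Each nonempty `S` of size `≤ d` is hit in exactly one free coordinate with probability
`≥ 1/(4d)`** when every coordinate is fixed independently with probability `1 - 1/(2d)`
(`Pr[|S ∖ A| = 1] ≥ 2 E|S ∖ A| - E|S ∖ A|² = q|S|(1 - q(|S|-1))`, `q = 1/(2d)`).
[cite: DinurEtAl2007, §4 ("A simple calculation shows that E[γ_i] = …")] -/
theorem sum_subsetWeight_ite_card_sdiff_eq_one_ge {d : ℕ} (hd : 1 ≤ d) (S : Finset (Fin m))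
    (hS1 : 1 ≤ S.card) (hSd : S.card ≤ d) :
    1 / (4 * (d : ℝ)) ≤ ∑ A : Finset (Fin m),
      subsetWeight (1 / (2 * (d : ℝ))) A * (if (S \ A).card = 1 then (1 : ℝ) else 0) := by
  set q : ℝ := 1 / (2 * (d : ℝ)) with hq
  have hdpos : (0 : ℝ) < d := by exact_mod_cast hd
  have hd1 : (1 : ℝ) ≤ d := by exact_mod_cast hd
  have hq0 : 0 ≤ q := by positivity
  have hq1 : q ≤ 1 := by
    rw [hq, div_le_one (by positivity)]; linarith
  have hlow : ∑ A : Finset (Fin m), subsetWeight q A * (2 * ((S \ A).card : ℝ) - ((S \ A).card : ℝ) ^ 2) ≤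
      ∑ A : Finset (Fin m), subsetWeight q A * (if (S \ A).card = 1 then (1 : ℝ) else 0) :=
    Finset.sum_le_sum fun A _ =>
      mul_le_mul_of_nonneg_left (two_mul_sub_sq_le_ite _) (subsetWeight_nonneg hq0 hq1 A)
  have hval : ∑ A : Finset (Fin m), subsetWeight q A * (2 * ((S \ A).card : ℝ) - ((S \ A).card : ℝ) ^ 2) =
      q * S.card * (1 - q * (S.card - 1)) := by
    have e : ∀ A : Finset (Fin m), subsetWeight q A * (2 * ((S \ A).card : ℝ) - ((S \ A).card : ℝ) ^ 2) =
        2 * (subsetWeight q A * ((S \ A).card : ℝ)) - subsetWeight q A * ((S \ A).card : ℝ) ^ 2 := by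
      intro A; ring
    simp_rw [e]
    rw [Finset.sum_sub_distrib, ← Finset.mul_sum, sum_subsetWeight_card_sdiff,
      sum_subsetWeight_card_sdiff_sq]
    ring
  refine le_trans ?_ hlow
  rw [hval]
  have hs1 : (1 : ℝ) ≤ S.card := by exact_mod_cast hS1
  have hsd : (S.card : ℝ) ≤ d := by exact_mod_cast hSd
  -- `q s (1 - q (s-1)) = s (2d - s + 1) / (4 d²) ≥ 1/(4d)`
  have e : q * S.card * (1 - q * (S.card - 1)) = (S.card * (2 * d - S.card + 1)) / (4 * (d : ℝ) ^ 2) := by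
    rw [hq]; field_simp; ring
  rw [e, div_le_div_iff₀ (by positivity) (by positivity)]
  nlinarith [mul_nonneg (sub_nonneg.2 hs1) (by linarith : (0 : ℝ) ≤ 2 * d - S.card)]

/-- **The averaged restriction inequality** (sup-norm form of DFKO Thm. 1.6): for
`g : {0,1}^m → [0,1]` of degree `≤ d` (`d ≥ 1`) with `∑_{S∋i} ĝ(S)² ≤ t` for all `i`, and every
`θ > 0`, `W^{≥1}[g] ≤ 4d (d 2^d θ + 9^{d-1} d t / θ²)`. [cite: DinurEtAl2007, §4 (proof of Thm. 1.6)] -/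
theorem tailWeight_one_le {g : (Fin m → Bool) → ℝ} (h0 : ∀ x, 0 ≤ g x)
    (h1 : ∀ x, g x ≤ 1) {d : ℕ} (hd : 1 ≤ d)
    (hdeg : ∀ S : Finset (Fin m), d < S.card → cubeFourierCoeff g S = 0) {t : ℝ} (ht : 0 ≤ t)
    (hI : ∀ i, ∑ S ∈ Finset.univ.filter (fun S : Finset (Fin m) => i ∈ S), cubeFourierCoeff g S ^ 2 ≤ t)
    {θ : ℝ} (hθ : 0 < θ) :
    tailWeight g 1 ≤ 4 * d * (d * 2 ^ d * θ + (9 : ℝ) ^ (d - 1) * d * t / θ ^ 2) := by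
  set q : ℝ := 1 / (2 * (d : ℝ)) with hq
  set R : ℝ := d * 2 ^ d * θ + (9 : ℝ) ^ (d - 1) * d * t / θ ^ 2 with hR
  have hdpos : (0 : ℝ) < d := by exact_mod_cast hd
  have hq0 : 0 ≤ q := by positivity
  have hq1 : q ≤ 1 := by
    rw [hq, div_le_one (by positivity)]
    have : (1 : ℝ) ≤ d := by exact_mod_cast hd
    linarith
  -- upper bound of the average
  have hup : ∑ A : Finset (Fin m), subsetWeight q A *
      ∑ S ∈ Finset.univ.filter (fun S : Finset (Fin m) => (S \ A).card = 1), cubeFourierCoeff g S ^ 2 ≤ R := by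
    calc _ ≤ ∑ A : Finset (Fin m), subsetWeight q A * R :=
          Finset.sum_le_sum fun A _ => mul_le_mul_of_nonneg_left
            (sum_filter_card_sdiff_eq_one_le h0 h1 hd hdeg ht hI A hθ) (subsetWeight_nonneg hq0 hq1 A)
      _ = R := by rw [← Finset.sum_mul, sum_subsetWeight, one_mul]
  -- lower bound of the average
  have hlow : tailWeight g 1 / (4 * d) ≤ ∑ A : Finset (Fin m), subsetWeight q A *
      ∑ S ∈ Finset.univ.filter (fun S : Finset (Fin m) => (S \ A).card = 1), cubeFourierCoeff g S ^ 2 := by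
    -- exchange the sums
    have hex : ∑ A : Finset (Fin m), subsetWeight q A *
        ∑ S ∈ Finset.univ.filter (fun S : Finset (Fin m) => (S \ A).card = 1), cubeFourierCoeff g S ^ 2 =
        ∑ S : Finset (Fin m), cubeFourierCoeff g S ^ 2 *
          ∑ A : Finset (Fin m), subsetWeight q A * (if (S \ A).card = 1 then (1 : ℝ) else 0) := by
      simp_rw [Finset.sum_filter, Finset.mul_sum]
      rw [Finset.sum_comm]
      refine Finset.sum_congr rfl fun S _ => Finset.sum_congr rfl fun A _ => ?_
      split_ifs <;> ring
    rw [hex, tailWeight, Finset.sum_filter, Finset.sum_div]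
    refine Finset.sum_le_sum fun S _ => ?_
    split_ifs with hS
    · by_cases hSd : d < S.card
      · rw [hdeg S hSd]; simp
      · rw [div_eq_mul_one_div]
        exact mul_le_mul_of_nonneg_left
          (sum_subsetWeight_ite_card_sdiff_eq_one_ge hd S hS (not_lt.1 hSd)) (sq_nonneg _)
    · rw [zero_div]
      exact mul_nonneg (sq_nonneg _) (Finset.sum_nonneg fun A _ =>
        mul_nonneg (subsetWeight_nonneg hq0 hq1 A)
          (show (0 : ℝ) ≤ (if (S \ A).card = 1 then (1 : ℝ) else 0) by split_ifs <;> norm_num))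
  have h := hlow.trans hup
  rwa [div_le_iff₀' (by positivity)] at h

/-- **Small influences force small variance** (the DFKO bound in sup-norm form, with exponent 3):
for `g : {0,1}^m → [0,1]` of degree `≤ d` (`d ≥ 1`) with `∑_{S∋i} ĝ(S)² ≤ t` for all `i`
(`t ≥ 0`), `(W^{≥1}[g])³ ≤ 2^{21 d} t`. [cite: DinurEtAl2007, Thm. 1.6 (= preprint Thm. 3; sup-norm consequence)] -/
theorem tailWeight_one_pow_three_le {g : (Fin m → Bool) → ℝ} (h0 : ∀ x, 0 ≤ g x)
    (h1 : ∀ x, g x ≤ 1) {d : ℕ} (hd : 1 ≤ d)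
    (hdeg : ∀ S : Finset (Fin m), d < S.card → cubeFourierCoeff g S = 0) {t : ℝ} (ht : 0 ≤ t)
    (hI : ∀ i, ∑ S ∈ Finset.univ.filter (fun S : Finset (Fin m) => i ∈ S), cubeFourierCoeff g S ^ 2 ≤ t) :
    tailWeight g 1 ^ 3 ≤ (2 : ℝ) ^ (21 * d) * t := by
  set W := tailWeight g 1 with hW_def
  have hW0 : 0 ≤ W := tailWeight_nonneg g 1
  have hdpos : (0 : ℝ) < d := by exact_mod_cast hd
  rcases hW0.eq_or_lt with hWz | hWpos
  · rw [← hWz]; norm_num; positivity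
  -- `θ = W / (8 d² 2^d)`
  set K : ℝ := 8 * (d : ℝ) ^ 2 * 2 ^ d with hK
  have hKpos : 0 < K := by positivity
  set θ : ℝ := W / K with hθ_def
  have hθ : 0 < θ := div_pos hWpos hKpos
  have key := tailWeight_one_le h0 h1 hd hdeg ht hI hθ
  rw [← hW_def] at key
  -- `4d · d 2^d θ = W/2`
  have hhalf : 4 * (d : ℝ) * (d * 2 ^ d * θ) = W / 2 := by
    rw [hθ_def, hK]; field_simp; ring
  have hθK : θ ^ 2 = W ^ 2 / K ^ 2 := by rw [hθ_def, div_pow]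
  -- hence `W/2 ≤ 4 d² 9^{d-1} t K² / W²`, i.e. `W³ ≤ 8 d² 9^{d-1} K² t`
  have h2 : W / 2 ≤ 4 * (d : ℝ) * ((9 : ℝ) ^ (d - 1) * d * t) * K ^ 2 / W ^ 2 := by
    have e : 4 * (d : ℝ) * (d * 2 ^ d * θ + (9 : ℝ) ^ (d - 1) * d * t / θ ^ 2) =
        W / 2 + 4 * (d : ℝ) * ((9 : ℝ) ^ (d - 1) * d * t) * K ^ 2 / W ^ 2 := by
      rw [mul_add, hhalf, hθK]
      field_simp
    rw [e] at key
    linarith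
  have hW2 : 0 < W ^ 2 := pow_pos hWpos 2
  have h3 : W ^ 3 ≤ 8 * (d : ℝ) ^ 2 * (9 : ℝ) ^ (d - 1) * K ^ 2 * t := by
    rw [le_div_iff₀ hW2] at h2
    nlinarith
  -- the constant: `8 d² 9^{d-1} K² = 512 d⁶ 4^d 9^{d-1} ≤ 2^{21 d}`
  have h9 : (9 : ℝ) ^ (d - 1) ≤ 9 ^ d := pow_le_pow_right₀ (by norm_num) (Nat.sub_le d 1)
  have hnat : 512 * d ^ 6 * (4 ^ d * 9 ^ d) ≤ 2 ^ (21 * d) := by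
    have e1 : d ^ 6 ≤ 2 ^ (6 * d) := by
      calc d ^ 6 ≤ (2 ^ d) ^ 6 := Nat.pow_le_pow_left Nat.lt_two_pow_self.le 6
        _ = 2 ^ (6 * d) := by rw [← pow_mul, mul_comm]
    have e2 : 4 ^ d * 9 ^ d ≤ 2 ^ (6 * d) := by
      rw [← mul_pow, pow_mul]
      exact Nat.pow_le_pow_left (by norm_num) d
    have e3 : 512 ≤ 2 ^ (9 * d) := by
      calc 512 = 2 ^ 9 := by norm_num
        _ ≤ 2 ^ (9 * d) := Nat.pow_le_pow_right (by norm_num) (by omega)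
    calc 512 * d ^ 6 * (4 ^ d * 9 ^ d) ≤ 2 ^ (9 * d) * 2 ^ (6 * d) * 2 ^ (6 * d) :=
          Nat.mul_le_mul (Nat.mul_le_mul e3 e1) e2
      _ = 2 ^ (21 * d) := by rw [← pow_add, ← pow_add]; ring_nf
  have hreal : (512 : ℝ) * d ^ 6 * (4 ^ d * 9 ^ d) ≤ 2 ^ (21 * d) := by exact_mod_cast hnat
  have hKsq : K ^ 2 = 64 * (d : ℝ) ^ 4 * 4 ^ d := by
    have h4 : ((2 : ℝ) ^ d) ^ 2 = 4 ^ d := by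
      rw [← pow_mul, mul_comm, pow_mul]; norm_num
    rw [hK, mul_pow, mul_pow, h4]; ring
  calc W ^ 3 ≤ 8 * (d : ℝ) ^ 2 * (9 : ℝ) ^ (d - 1) * K ^ 2 * t := h3
    _ ≤ 8 * (d : ℝ) ^ 2 * (9 : ℝ) ^ d * K ^ 2 * t := by gcongr
    _ = (512 : ℝ) * d ^ 6 * (4 ^ d * 9 ^ d) * t := by rw [hKsq]; ring
    _ ≤ 2 ^ (21 * d) * t := mul_le_mul_of_nonneg_right hreal ht

end DFKO

/-! ### The variance in the Walsh basis and the discharge -/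

open Finset Literature.Computability.Complexity.LowDegree Literature.Probability.RandomGraphs.LowDegree in
/-- `Var[p] = ∑_{S ≠ ∅} p̂(S)² = W^{≥1}[p]`. [cite: ODonnell2014, §1.4 (Parseval)] -/
theorem boolVariance_eq_tailWeight_one {N : ℕ} (p : MvPolynomial (Fin N) ℝ) :
    boolVariance p = tailWeight (evalBool p) 1 := by
  set g := evalBool p with hg
  set μ : ℝ := (∑ x, g x) / 2 ^ N with hμ
  set g' : (Fin N → Bool) → ℝ := fun x => g x - μ with hg'
  have hN : (0 : ℝ) < 2 ^ N := by positivity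
  have hvar : boolVariance p = (∑ x, g' x ^ 2) / 2 ^ N := rfl
  have hpar : (∑ x, g' x ^ 2) / 2 ^ N = ∑ S, cubeFourierCoeff g' S ^ 2 := (sum_cubeFourierCoeff_sq g').symm
  have hcoef : ∀ S : Finset (Fin N), S ≠ ∅ → cubeFourierCoeff g' S = cubeFourierCoeff g S := by
    intro S hS
    rw [hg', cubeFourierCoeff_sub, cubeFourierCoeff_const hS, sub_zero]
  have hempty : cubeFourierCoeff g' ∅ = 0 := by
    rw [cubeFourierCoeff_empty, hg']
    simp only [Finset.sum_sub_distrib, Finset.sum_const, Finset.card_univ, Fintype.card_fun,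
      Fintype.card_bool, Fintype.card_fin, nsmul_eq_mul]
    rw [hμ]; push_cast; field_simp; ring
  rw [hvar, hpar, ← Finset.add_sum_erase _ _ (Finset.mem_univ ∅), hempty]
  simp only [ne_eq, zero_pow, OfNat.ofNat_ne_zero, not_false_eq_true, zero_add]
  rw [tailWeight]
  refine Finset.sum_congr ?_ fun S hS => ?_
  · ext S
    simp only [Finset.mem_erase, ne_eq, Finset.mem_univ, and_true, Finset.mem_filter, true_and,
      Finset.one_le_card, Finset.nonempty_iff_ne_empty]
  · rw [hcoef S (Finset.one_le_card.1 (Finset.mem_filter.1 hS).2).ne_empty]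

open Finset Literature.Computability.Complexity.LowDegree Literature.Probability.RandomGraphs.LowDegree in
/-- **Discharge of `dfko2007_influence_bounded`** with `a = 3`, `C = 21`: for every real polynomial
`p` of total degree `≤ d` (`d ≥ 1`) with `0 ≤ p ≤ 1` on `{0,1}^N` and `0 < ε ≤ Var[p]`, some
variable has `Inf_i[p] ≥ ε³ / 2^{21 d}`. Proof (sup-norm skeleton of Dinur–Friedgut–Kindler–O'Donnell,
§3–4): if all `Inf_i[p] < ε³/2^{21d}` then `DFKO.tailWeight_one_pow_three_le` gives
`Var[p]³ ≤ 2^{21d} · ε³/(4 · 2^{21d}) < ε³ ≤ Var[p]³`. [cite: DinurEtAl2007, Thm. 1.6 = preprint Thm. 3 (consequence; proof §3–4)] -/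
theorem dfko2007_influence_bounded_holds : dfko2007_influence_bounded := by
  refine ⟨3, 21, fun N d p ε hd hp hb hε hv => ?_⟩
  by_contra hcon
  push Not at hcon
  set g := evalBool p with hg
  have h0 : ∀ x, 0 ≤ g x := fun x => (hb x).1
  have h1 : ∀ x, g x ≤ 1 := fun x => (hb x).2
  have hdeg : ∀ S : Finset (Fin N), d < S.card → cubeFourierCoeff g S = 0 :=
    fun S hS => cubeFourierCoeff_evalBool_eq_zero hp hS
  set t : ℝ := ε ^ 3 / (2 : ℝ) ^ (21 * d) / 4 with ht_def
  have ht : 0 ≤ t := by positivity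
  have hI : ∀ i, ∑ S ∈ Finset.univ.filter (fun S : Finset (Fin N) => i ∈ S), cubeFourierCoeff g S ^ 2 ≤ t := by
    intro i
    have h := hcon i
    rw [influence_eq_sum_sq_fourier] at h
    rw [ht_def]
    linarith
  have main := DFKO.tailWeight_one_pow_three_le h0 h1 hd hdeg ht hI
  rw [← boolVariance_eq_tailWeight_one] at main
  have h2 : (0 : ℝ) < (2 : ℝ) ^ (21 * d) := by positivity
  have hε3 : ε ^ 3 ≤ boolVariance p ^ 3 := pow_le_pow_left₀ hε.le hv 3
  have : (2 : ℝ) ^ (21 * d) * t = ε ^ 3 / 4 := by rw [ht_def]; field_simp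
  rw [this] at main
  nlinarith [pow_pos hε 3]

end Literature.Computability.QuantumComplexity
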